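import Literature.Probability.RandomPlanarGeometry.RestrictionMeasuresFiveEighthsInterior
import Literature.Probability.RandomPlanarGeometry.RestrictionZeroOne
import HarnessLib

/-!
# [LSW] "for `α > 5/8`, `P_α` has interior points almost surely" from any `P_1`: the `α > 5/8` leaf without bubbles

Proof-only assembly (no definition, no named fact) for the named fact
`Literature.Probability.RandomPlanarGeometry.IsRestrictionMeasure.ae_interior_nonempty_of_gt_five_eighths`
(`RestrictionMeasuresFiveEighths`: for `α > 5/8` and every two-sided restriction measure `P` of
exponent `α`, `P`-almost every `K` has nonempty interior), after

* G. F. Lawler, O. Schramm, W. Werner, *Conformal restriction: the chordal case*, J. Amer. Math.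
  Soc. **16** (2003) 917–955, arXiv:math/0209343 (**[LSW]**), p. 4 ("when `α` is greater than
  `5/8`, it is not supported on simple paths"), Thm. 7.3 and the sentence after its proof
  (p. 29), §3 p. 10 (restriction property, Lemma 3.2), §8.1–8.2, proof of Cor. 8.6 (p. 38).

In [LSW] this is read off Thm. 7.3 (the Brownian bubbles of the construction have interior
points); the tree's reduction along that line
(`IsRestrictionMeasure.ae_interior_nonempty_of_gt_five_eighths_of_three_leaves`,
`SLEBubblesVersionHolds`) needs a Brownian bubble measure WITH INTERIOR POINTS
(`exists_isBrownianBubbleMeasure_ae_interior_nonempty`), `Ξ(κ) ∈ Ω` a.s. and Thm. 6.5. Here the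
fact is derived from the EXISTENCE OF SOME TWO-SIDED RESTRICTION MEASURE OF EXPONENT `1` alone,
by two theorems of the tree proved for this purpose:

1. positivity — `P_α{int K ≠ ∅} ≥ P_α{i ∈ int K} > 0` for every `P_α`, `α > 5/8`, given any
   `P_1` (`IsRestrictionMeasure.measure_interior_nonempty_ne_zero_of_gt_five_eighths`,
   `RestrictionMeasuresFiveEighthsInterior`: the one-sided squeeze against
   `P⁺_{α−5/8} = ` left-filled hung cloud of `P_1`-samples, which makes `i` interior with
   positive probability, `OneSidedExcursionCloudInterior`);
2. the zero–one law — `P_α{int K ≠ ∅} ∈ {0, 1}`, the event being invariant under the maps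
   `Φ_A` and `P_α` having the restriction property
   (`IsRestrictionMeasure.ae_interior_nonempty_of_measure_ne_zero`, `RestrictionZeroOne`).

Hence (all PROVED):

* `IsRestrictionMeasure.ae_interior_nonempty_of_gt_five_eighths_of_exists_one` — **the named
  fact from any `P_1`**;
* `…_of_forall_gt` — from the existence of `P_α` for all `α > 5/8`; `…_of_iff` — from [LSW]
  p. 5 result 1 (`exists_isRestrictionMeasure_iff`, which contains `P_1`);
  `…_of_three_leaves''` — from the three EXISTENCE-ONLY §7 leaves
  (`exists_isBrownianBubbleMeasure`, `SLEBubbles.ae_mem_restrictionConfigs`,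
  `SLEBubbles.lintegral_poissonAvoidance_eq_rpow`), the interior property of the bubbles being
  no longer needed;
* the existential interior form of Thm. 7.3 (`exists_isRestrictionMeasure_ae_interior_nonempty`,
  `RestrictionMeasuresBubbles`) is EQUIVALENT to bare existence above `5/8`
  (`exists_isRestrictionMeasure_ae_interior_nonempty_iff_forall_gt`), and follows from the
  three existence-only leaves (`…_of_three_leaves''`).

The discharge `IsRestrictionMeasure.ae_interior_nonempty_of_gt_five_eighths_holds` is
`…_of_exists_one` applied to any proof of `∃ P, IsRestrictionMeasure 1 P` — e.g.
`…_of_iff exists_isRestrictionMeasure_iff_holds` or `…_of_three_leaves''` with the three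
`_holds` theorems — once one of these exists.

## References

* [LSW] p. 4; §3 p. 10; Thm. 7.3 (p. 29); §8.1–8.2; Cor. 8.6 (pp. 37–38).
  [LawlerSchrammWerner2003Restriction]
* G. F. Lawler, *Conformally Invariant Processes in the Plane*, AMS (2005), §9.2 Prop. 9.13,
  Cor. 9.11. [Lawler2005]
-/

noncomputable section

open MeasureTheory

namespace Literature.Probability.RandomPlanarGeometry

/-- **[LSW]: for `α > 5/8`, `P_α`-almost every configuration has an interior point — from ANY
two-sided restriction measure of exponent `1`** (positivity by the one-sided squeeze, almost
sureness by the zero–one law). [cite: LawlerSchrammWerner2003Restriction, p. 4 and Thm. 7.3 (p. 29); §3 p. 10; §8.1–8.2] -/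
theorem IsRestrictionMeasure.ae_interior_nonempty_of_gt_five_eighths_of_exists_one
    (h1 : ∃ P₁ : Measure RestrictionConfig, IsRestrictionMeasure 1 P₁) :
    IsRestrictionMeasure.ae_interior_nonempty_of_gt_five_eighths :=
  fun hP hα ↦ hP.ae_interior_nonempty_of_measure_ne_zero
    (hP.measure_interior_nonempty_ne_zero_of_gt_five_eighths hα h1)

/-- The fact from the existence of `P_α` for every `α > 5/8` (take `α = 1`).
[cite: LawlerSchrammWerner2003Restriction, p. 4 and Thm. 7.3 (p. 29)] -/
theorem IsRestrictionMeasure.ae_interior_nonempty_of_gt_five_eighths_of_forall_gt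
    (hgt : ∀ α : ℝ, 5 / 8 < α → ∃ P : Measure RestrictionConfig, IsRestrictionMeasure α P) :
    IsRestrictionMeasure.ae_interior_nonempty_of_gt_five_eighths :=
  IsRestrictionMeasure.ae_interior_nonempty_of_gt_five_eighths_of_exists_one (hgt 1 (by norm_num))

/-- **The fact from [LSW] p. 5 result 1** (`exists_isRestrictionMeasure_iff`: `P_α` exists iff
`α ≥ 5/8`; in particular `P_1` exists). [cite: LawlerSchrammWerner2003Restriction, p. 5 results 1–2; Thm. 7.3 (p. 29)] -/
theorem IsRestrictionMeasure.ae_interior_nonempty_of_gt_five_eighths_of_iff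
    (h : exists_isRestrictionMeasure_iff) :
    IsRestrictionMeasure.ae_interior_nonempty_of_gt_five_eighths :=
  IsRestrictionMeasure.ae_interior_nonempty_of_gt_five_eighths_of_exists_one ((h 1 one_pos).2 (by norm_num))

/-- **The fact from the three EXISTENCE-ONLY §7 leaves** — a Brownian bubble measure (§7.1),
`Ξ(κ) ∈ Ω` almost surely, Theorem 6.5 — which give `P_1` as the law of `Ξ(2)`
(`exists_isRestrictionMeasure_one_of_three_leaves`); the interior property of the bubbles
(`IsBrownianBubbleMeasure.ae_interior_nonempty`) is not needed. Its discharge is this theorem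
applied to `exists_isBrownianBubbleMeasure_holds`, `SLEBubbles.ae_mem_restrictionConfigs_holds`,
`SLEBubbles.lintegral_poissonAvoidance_eq_rpow_holds`, once they exist.
[cite: LawlerSchrammWerner2003Restriction, Thm. 7.3 (p. 29) and the sentence following its proof] -/
theorem IsRestrictionMeasure.ae_interior_nonempty_of_gt_five_eighths_of_three_leaves''
    (hμex : exists_isBrownianBubbleMeasure) (hcfg : SLEBubbles.ae_mem_restrictionConfigs)
    (h65 : SLEBubbles.lintegral_poissonAvoidance_eq_rpow) :
    IsRestrictionMeasure.ae_interior_nonempty_of_gt_five_eighths :=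
  IsRestrictionMeasure.ae_interior_nonempty_of_gt_five_eighths_of_exists_one
    (exists_isRestrictionMeasure_one_of_three_leaves hμex hcfg h65)

/-! ### The existential interior form of Thm. 7.3 is bare existence above `5/8` -/

/-- **`exists_isRestrictionMeasure_ae_interior_nonempty` from existence above `5/8` alone.**
[cite: LawlerSchrammWerner2003Restriction, Thm. 7.3 (p. 29) and p. 4] -/
theorem exists_isRestrictionMeasure_ae_interior_nonempty_of_forall_gt
    (hgt : ∀ α : ℝ, 5 / 8 < α → ∃ P : Measure RestrictionConfig, IsRestrictionMeasure α P) :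
    exists_isRestrictionMeasure_ae_interior_nonempty := by
  intro α hα
  obtain ⟨P, hP⟩ := hgt α hα
  exact ⟨P, hP, IsRestrictionMeasure.ae_interior_nonempty_of_gt_five_eighths_of_forall_gt hgt hP hα⟩

/-- **`exists_isRestrictionMeasure_ae_interior_nonempty ⟺ P_α` exists for every `α > 5/8`.**
[cite: LawlerSchrammWerner2003Restriction, Thm. 7.3 (p. 29) and p. 4] -/
theorem exists_isRestrictionMeasure_ae_interior_nonempty_iff_forall_gt :
    exists_isRestrictionMeasure_ae_interior_nonempty ↔
      ∀ α : ℝ, 5 / 8 < α → ∃ P : Measure RestrictionConfig, IsRestrictionMeasure α P :=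
  ⟨fun h α hα ↦ (h α hα).imp fun _ hP ↦ hP.1, exists_isRestrictionMeasure_ae_interior_nonempty_of_forall_gt⟩

/-- `exists_isRestrictionMeasure_ae_interior_nonempty` from [LSW] p. 5 result 1. [cite: LawlerSchrammWerner2003Restriction, p. 5 result 1 with Thm. 7.3 (p. 29)] -/
theorem exists_isRestrictionMeasure_ae_interior_nonempty_of_iff (h : exists_isRestrictionMeasure_iff) :
    exists_isRestrictionMeasure_ae_interior_nonempty :=
  exists_isRestrictionMeasure_ae_interior_nonempty_of_forall_gt fun α hα ↦
    (h α (by linarith)).2 hα.le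

/-- **`exists_isRestrictionMeasure_ae_interior_nonempty` from the three EXISTENCE-ONLY §7
leaves** (previously from the bubble measure with interior points,
`exists_isRestrictionMeasure_ae_interior_nonempty_of_three_leaves`).
[cite: LawlerSchrammWerner2003Restriction, Thm. 7.3 (p. 29) and the sentence following its proof] -/
theorem exists_isRestrictionMeasure_ae_interior_nonempty_of_three_leaves''
    (hμex : exists_isBrownianBubbleMeasure) (hcfg : SLEBubbles.ae_mem_restrictionConfigs)
    (h65 : SLEBubbles.lintegral_poissonAvoidance_eq_rpow) :
    exists_isRestrictionMeasure_ae_interior_nonempty :=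
  exists_isRestrictionMeasure_ae_interior_nonempty_of_forall_gt fun _ hα ↦
    exists_isRestrictionMeasure_of_five_eighths_le_of_three_leaves hμex hcfg h65 hα.le

end Literature.Probability.RandomPlanarGeometry

end
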